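import Literature.NumberTheory.Automorphic.ShimuraCurveCartanLevelHeckeCosets
import HarnessLib

/-!
# Erasing one Cartan place: the cover order `O + (∏_{C∖q} p) O₀` of a Cartan datum
# `X : CartanLevelCurveData D M C` is again a Cartan datum, of level `(M; C∖q)`

Topic `NumberTheory/Automorphic`; one definition with body and its elementary API (no named fact,
no instance, no `sorry`). For `X : CartanLevelCurveData D M C` (`ShimuraCurveCartanLevel.lean`: an
indefinite quaternion algebra `B/ℚ` of discriminant `D` with real splitting `ι`, Eichler hull `O₀` of
level `M`, Cartan order `O ⊆ O₀` — equal to `O₀` away from `C` and to the non-split Cartan order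
`ℤ_{q²} + q O₀,q` at `q ∈ C`) and a natural number `q`, the **cover order**

  `X.eraseOrder q := X.O ⊔ (∏_{p ∈ C∖q} p) • X.O₀`

is locally `X.O₀` at `q` and `X.O` everywhere else, i.e. it is the Cartan order of level `(M; C∖q)`
in the same hull (Kohen–Pacetti's `Γ_ns^ε(N/q…) ∩ Γ₀(m)`-type groups one Cartan place up; the
order whose norm-one group carries the full-level-`q` cover of the Cartan curve in the BSD cell's
crux `CartanOnePlaceDegreeLawAtThree`, there written `CartanCover.coverOrder X q` with the SAME body,
and the binder `hO'` of the named facts `jacquetLanglands_cartanCover_newform`,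
`unitsHeckeFun_comm_cartanCover` of `QuaternionOrderHeckeJacquetLanglands.lean`). This file packages it
as a Cartan datum

  `X.eraseLevel q : CartanLevelCurveData D M (C.erase q)`

(same `B`, `ι`, `O₀`; `O := X.eraseOrder q`; a measurable fundamental domain of `ι(O'¹)` chosen by
`exists_isHypFundamentalDomain_normOneUnits_of_algHom`), so that every theorem about Cartan data —
the Hecke degree `ℓ + 1` (`cartanLevel_card_heckeCosets_eq_holds`), strong approximation
(`exists_normOne_mul_mem`), the commutation `T_ℓ T_ℓ' = T_ℓ' T_ℓ`
(`ShimuraCurveCartanLevelHeckeCommute.lean`) — applies to the cover order verbatim.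

PROVED (elementary lattice algebra, no localisation): `eraseOrder` is an order between `X.O` and
`X.O₀` (`isOrder_eraseOrder`); for `q ∈ C` it equals `X.O + (∏_{C∖q} p)² • X.O₀`
(`eraseOrder_eq_sup_sq_smul`: `N' y = s q N' y + t N'² y` with `q N' O₀ ⊆ O`), whence the index
`[O₀ : O'] = ∏_{p ∈ C∖q} p²` by the tree's `relIndex_sup_smul_eq` (`[O₀ : O] = (q N')²`,
`gcd(q, N') = 1`); the saturation property at the places of `C∖q` (from `X.saturated`, correcting at
`q` by `N' t x` with `t N' ≡ 1 (mod q)`) and the division-ring property modulo `p ∈ C∖q` (from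
`X.isDivisionRing_mod`). For `q ∉ C` the cover order is `X.O` itself (`eraseOrder_eq_of_not_mem`).
Definitional bridges: `eraseLevel_O`, `eraseLevel_O₀`, `eraseLevel_ι`, `Gamma_eraseLevel`
(`= normOneUnits X.ι _`), `mem_heckeSet_eraseLevel_iff`. Filed by the BSD cell `bsd-stepL` (seat `defn-ty1`
g44). Nothing arithmetic is asserted; BSD is proved for no curve.

## References

* D. Kohen, A. Pacetti, *Heegner points on Cartan non-split curves*, Canad. J. Math. 68 (2016),
  §1.1 (non-split Cartan orders), §2 (the groups `Γ_ns^ε(N) ∩ Γ₀(m)`, arXiv:1403.7801v3 pp. 7–8).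
  [cite: KohenPacetti2016, §1.1 and §2]
* M.-F. Vignéras, *Arithmétique des algèbres de quaternions*, LNM 800 (1980), Ch. I §4 (orders,
  indices), Ch. IV §1. [cite: VignerasLNM800, Ch. I §4 and Ch. IV §1]
-/

noncomputable section

open scoped Pointwise MatrixGroups

namespace Literature.NumberTheory.Automorphic

namespace CartanLevelCurveData

variable {D M : ℕ} {C : Finset ℕ} (X : CartanLevelCurveData D M C)

/-! ### 1. The cover order `O' = O + (∏_{C∖q} p) • O₀` -/

/-- **The cover order at `q`**: `X.O ⊔ (∏_{p ∈ C∖q} p) • X.O₀` (the image of `X.O₀` under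
multiplication by `∏_{C∖q} p`, as in the binder `hO'` of `QuaternionOrderHeckeJacquetLanglands.lean`
and in `CartanCover.coverOrder`). Locally: `X.O₀` at `q`, `X.O` elsewhere.
[cite: KohenPacetti2016, §2 (arXiv:1403.7801v3 pp. 7–8)] -/
abbrev eraseOrder (q : ℕ) : Submodule ℤ X.B :=
  X.O ⊔ X.O₀.map ((((∏ p ∈ C.erase q, p : ℕ) : ℤ)) • LinearMap.id)

/-- Membership in the cover order: `x = a + N' • y`, `a ∈ X.O`, `y ∈ X.O₀`, `N' = ∏_{C∖q} p`.
[cite: KohenPacetti2016, §2] -/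
theorem mem_eraseOrder_iff (q : ℕ) {x : X.B} :
    x ∈ X.eraseOrder q ↔ ∃ a ∈ X.O, ∃ y ∈ X.O₀, x = a + (((∏ p ∈ C.erase q, p : ℕ) : ℤ)) • y := by
  rw [eraseOrder, Submodule.mem_sup]
  constructor
  · rintro ⟨a, ha, z, hz, rfl⟩
    rw [Submodule.mem_map] at hz
    obtain ⟨y, hy, rfl⟩ := hz
    exact ⟨a, ha, y, hy, by simp⟩
  · rintro ⟨a, ha, y, hy, rfl⟩
    exact ⟨a, ha, _, Submodule.mem_map.mpr ⟨y, hy, by simp⟩, rfl⟩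

/-- `X.O ⊆ O'`. [cite: KohenPacetti2016, §2] -/
theorem le_eraseOrder (q : ℕ) : X.O ≤ X.eraseOrder q := le_sup_left

/-- `N' • X.O₀ ⊆ O'`. [cite: KohenPacetti2016, §2] -/
theorem smul_mem_eraseOrder (q : ℕ) {y : X.B} (hy : y ∈ X.O₀) :
    (((∏ p ∈ C.erase q, p : ℕ) : ℤ)) • y ∈ X.eraseOrder q :=
  (X.mem_eraseOrder_iff q).mpr ⟨0, X.O.zero_mem, y, hy, by simp⟩

/-- `O' ⊆ X.O₀`. [cite: KohenPacetti2016, §2] -/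
theorem eraseOrder_le (q : ℕ) : X.eraseOrder q ≤ X.O₀ := by
  intro x hx
  obtain ⟨a, ha, y, hy, rfl⟩ := (X.mem_eraseOrder_iff q).mp hx
  exact X.O₀.add_mem (X.le ha) (X.O₀.smul_mem _ hy)

/-- `(∏_C p) = q · ∏_{C∖q} p` for `q ∈ C`. [cite: KohenPacetti2016, §2] -/
theorem prod_eq_mul_prod_erase {q : ℕ} (hq : q ∈ C) :
    ((∏ p ∈ C, p : ℕ) : ℤ) = (q : ℤ) * (((∏ p ∈ C.erase q, p : ℕ) : ℤ)) := by
  classical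
  rw [← Finset.mul_prod_erase C (fun p => p) hq]
  push_cast
  rfl

/-- `q • O' ⊆ X.O` for `q ∈ C` (`q · N' = ∏_C p` and `(∏_C p) • O₀ ⊆ O`). [cite: KohenPacetti2016, §2] -/
theorem smul_mem_O_of_mem_eraseOrder {q : ℕ} (hq : q ∈ C) {x : X.B} (hx : x ∈ X.eraseOrder q) :
    (q : ℤ) • x ∈ X.O := by
  obtain ⟨a, ha, y, hy, rfl⟩ := (X.mem_eraseOrder_iff q).mp hx
  rw [smul_add, smul_smul, ← prod_eq_mul_prod_erase hq]
  exact X.O.add_mem (X.O.smul_mem _ ha) (X.smul_mem y hy)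

/-- For `q ∉ C` the cover order is `X.O` itself (`(∏_C p) • O₀ ⊆ O`). [cite: KohenPacetti2016, §2] -/
theorem eraseOrder_eq_of_not_mem {q : ℕ} (hq : q ∉ C) : X.eraseOrder q = X.O := by
  refine le_antisymm ?_ (X.le_eraseOrder q)
  intro x hx
  obtain ⟨a, ha, y, hy, rfl⟩ := (X.mem_eraseOrder_iff q).mp hx
  rw [Finset.erase_eq_of_notMem hq]
  exact X.O.add_mem ha (X.smul_mem y hy)

/-- **The cover order is an order.** [cite: VignerasLNM800, Ch. I §4] -/
theorem isOrder_eraseOrder (q : ℕ) : Brandt.IsOrder X.B (X.eraseOrder q) where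
  one_mem := X.le_eraseOrder q X.isOrder.one_mem
  mul_mem := by
    intro a ha b hb
    obtain ⟨a₁, ha₁, y₁, hy₁, rfl⟩ := (X.mem_eraseOrder_iff q).mp ha
    obtain ⟨b₁, hb₁, y₂, hy₂, rfl⟩ := (X.mem_eraseOrder_iff q).mp hb
    have hO₀ := X.isEichlerOrder.isOrder
    set n : ℤ := (((∏ p ∈ C.erase q, p : ℕ) : ℤ)) with hn
    have e : (a₁ + n • y₁) * (b₁ + n • y₂) = a₁ * b₁ + n • (a₁ * y₂ + y₁ * b₁ + n • (y₁ * y₂)) := by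
      simp only [mul_add, add_mul, smul_mul_assoc, mul_smul_comm, smul_add, smul_smul]
      abel
    rw [e]
    refine (X.eraseOrder q).add_mem (X.le_eraseOrder q (X.isOrder.mul_mem a₁ ha₁ b₁ hb₁))
      (X.smul_mem_eraseOrder q ?_)
    refine X.O₀.add_mem (X.O₀.add_mem ?_ ?_) (X.O₀.smul_mem _ (hO₀.mul_mem y₁ hy₁ y₂ hy₂))
    · exact hO₀.mul_mem a₁ (X.le ha₁) y₂ hy₂
    · exact hO₀.mul_mem y₁ hy₁ b₁ (X.le hb₁)
  isFullLattice := by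
    refine ⟨?_, fun d => ?_⟩
    · exact Submodule.FG.sup X.isOrder.isFullLattice.1
        (Submodule.FG.map _ X.isEichlerOrder.isOrder.isFullLattice.1)
    · obtain ⟨n, hn, hnd⟩ := X.isOrder.isFullLattice.2 d
      exact ⟨n, hn, X.le_eraseOrder q hnd⟩

/-! ### 2. `O' = O + N'² • O₀` and the index `[O₀ : O'] = N'²` -/

/-- **`O + N' • O₀ = O + N'² • O₀` for `q ∈ C`** (`N' = ∏_{C∖q} p`): `⊇` is clear, and for `⊆` write
`1 = s q + t N'` (`gcd(q, N') = 1`), so `N' y = s (q N' y) + t (N'² y)` with `q N' y = (∏_C p) y ∈ O`.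
[cite: KohenPacetti2016, §1.1 and §2] -/
theorem eraseOrder_eq_sup_sq_smul {q : ℕ} (hq : q ∈ C) :
    X.eraseOrder q = X.O ⊔ (((∏ p ∈ C.erase q, p) ^ 2 : ℕ) : ℤ) • X.O₀ := by
  classical
  set N' : ℕ := ∏ p ∈ C.erase q, p with hN'
  have hqp : q.Prime := (X.coprime q hq).1
  have hcop : Nat.Coprime q N' := by
    rw [hN']
    exact Nat.Coprime.prod_right fun q' hq' =>
      (Nat.coprime_primes hqp (X.coprime q' (Finset.mem_of_mem_erase hq')).1).mpr
        (Finset.ne_of_mem_erase hq').symm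
  refine le_antisymm ?_ ?_
  · intro x hx
    obtain ⟨a, ha, y, hy, rfl⟩ := (X.mem_eraseOrder_iff q).mp hx
    refine Submodule.add_mem _ (Submodule.mem_sup_left ha) ?_
    obtain ⟨s, t, hst⟩ := Nat.isCoprime_iff_coprime.mpr hcop
    have e : ((N' : ℕ) : ℤ) • y = s • ((q : ℤ) • (((N' : ℕ) : ℤ) • y)) + t • ((((N' ^ 2 : ℕ) : ℤ)) • y) := by
      simp only [smul_smul, ← add_smul]
      congr 1
      push_cast
      linear_combination -((N' : ℤ)) * hst
    rw [e]
    refine Submodule.add_mem _ (Submodule.mem_sup_left (X.O.smul_mem s ?_))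
      (Submodule.mem_sup_right (Submodule.smul_mem _ t (Submodule.smul_mem_pointwise_smul y _ X.O₀ hy)))
    rw [smul_smul, ← prod_eq_mul_prod_erase hq]
    exact X.smul_mem y hy
  · refine sup_le (X.le_eraseOrder q) fun z hz => ?_
    obtain ⟨y, hy, rfl⟩ := (Submodule.mem_smul_pointwise_iff_exists z _ X.O₀).mp hz
    have e : (((N' ^ 2 : ℕ) : ℤ)) • y = ((N' : ℕ) : ℤ) • (((N' : ℕ) : ℤ) • y) := by
      rw [smul_smul]; push_cast; ring_nf
    rw [e]
    exact X.smul_mem_eraseOrder q (X.O₀.smul_mem _ hy)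

/-- **`[O₀ : O'] = ∏_{p ∈ C∖q} p²`** (for `q ∈ C`: `[O₀ : O] = (q N')²`, `gcd(q, N') = 1`, and
`O' = O + N'² O₀` has index `N'²` by `relIndex_sup_smul_eq`; for `q ∉ C`: `O' = O`).
[cite: VignerasLNM800, Ch. I §4] [cite: KohenPacetti2016, §1.1] -/
theorem relIndex_eraseOrder (q : ℕ) :
    (X.eraseOrder q).toAddSubgroup.relIndex X.O₀.toAddSubgroup = ∏ p ∈ C.erase q, p ^ 2 := by
  classical
  by_cases hq : q ∈ C
  · set N' : ℕ := ∏ p ∈ C.erase q, p with hN'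
    have hqp : q.Prime := (X.coprime q hq).1
    have hN'0 : N' ≠ 0 := Finset.prod_ne_zero_iff.mpr fun q' hq' =>
      (X.coprime q' (Finset.mem_of_mem_erase hq')).1.ne_zero
    have hcop : Nat.Coprime N' q := by
      rw [hN']
      exact Nat.Coprime.prod_left fun q' hq' =>
        (Nat.coprime_primes (X.coprime q' (Finset.mem_of_mem_erase hq')).1 hqp).mpr
          (Finset.ne_of_mem_erase hq')
    have hidx : X.O.toAddSubgroup.relIndex X.O₀.toAddSubgroup = (N' * q) ^ 2 := by
      rw [X.relIndex_eq, Finset.prod_pow, ← Finset.prod_erase_mul C (fun q' => q') hq]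
    rw [X.eraseOrder_eq_sup_sq_smul hq, (relIndex_sup_smul_eq X.le hN'0 hqp.ne_zero hcop hidx).1, hN',
      Finset.prod_pow]
  · rw [X.eraseOrder_eq_of_not_mem hq, X.relIndex_eq, Finset.erase_eq_of_notMem hq]

/-! ### 3. Saturation and the division-ring property at the remaining Cartan places -/

/-- **Saturation of the cover order at the places of `C∖q`**: an element of `O₀` congruent modulo
`p O₀` to an element of `O'` for every `p ∈ C∖q` lies in `O'`. (For `q ∈ C`: with `t N' ≡ 1 (mod q)`,
`x - N' t x ∈ q O₀` and `x - N' t x ≡ x` modulo every `p ∈ C∖q`, so `X.saturated` puts `x - N' t x`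
in `O`, and `x = (x - N' t x) + N' (t x) ∈ O'`.) [cite: KohenPacetti2016, §1.1 and §2] -/
theorem eraseOrder_saturated (q : ℕ) {x : X.B} (hx : x ∈ X.O₀)
    (h : ∀ p ∈ C.erase q, ∃ a ∈ X.eraseOrder q, ∃ y ∈ X.O₀, x - a = (p : ℤ) • y) :
    x ∈ X.eraseOrder q := by
  classical
  set N' : ℕ := ∏ p ∈ C.erase q, p with hN'
  -- congruences modulo `p ∈ C∖q` to elements of `X.O`
  have h' : ∀ p ∈ C.erase q, ∃ a ∈ X.O, ∃ y ∈ X.O₀, x - a = (p : ℤ) • y := by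
    intro p hp
    obtain ⟨a, ha, y, hy, hxy⟩ := h p hp
    obtain ⟨a', ha', y', hy', rfl⟩ := (X.mem_eraseOrder_iff q).mp ha
    obtain ⟨k, hk⟩ : p ∣ N' := Finset.dvd_prod_of_mem _ hp
    refine ⟨a', ha', y + (k : ℤ) • y', X.O₀.add_mem hy (X.O₀.smul_mem _ hy'), ?_⟩
    have e : x - a' = (x - (a' + ((N' : ℕ) : ℤ) • y')) + ((N' : ℕ) : ℤ) • y' := by abel
    rw [e, hxy, hk, smul_add, smul_smul]
    push_cast
    ring_nf
  by_cases hq : q ∈ C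
  · have hqp : q.Prime := (X.coprime q hq).1
    have hcop : Nat.Coprime N' q := by
      rw [hN']
      exact Nat.Coprime.prod_left fun q' hq' =>
        (Nat.coprime_primes (X.coprime q' (Finset.mem_of_mem_erase hq')).1 hqp).mpr
          (Finset.ne_of_mem_erase hq')
    obtain ⟨t, s, hts⟩ := Nat.isCoprime_iff_coprime.mpr hcop
    -- `x₁ = x - N' • (t • x) ∈ O` by `X.saturated`
    set x₁ : X.B := x - ((N' : ℕ) : ℤ) • (t • x) with hx₁
    have hx₁O₀ : x₁ ∈ X.O₀ := X.O₀.sub_mem hx (X.O₀.smul_mem _ (X.O₀.smul_mem _ hx))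
    have hx₁O : x₁ ∈ X.O := by
      refine X.saturated x₁ hx₁O₀ fun p hp => ?_
      by_cases hpq : p = q
      · subst hpq
        refine ⟨0, X.O.zero_mem, s • x, X.O₀.smul_mem _ hx, ?_⟩
        rw [hx₁, sub_zero, smul_smul, smul_smul]
        have e : x - (((N' : ℕ) : ℤ) * t) • x = (1 - ((N' : ℕ) : ℤ) * t) • x := by
          rw [sub_smul, one_smul]
        rw [e]
        congr 1
        linear_combination -hts
      · obtain ⟨a, ha, y, hy, hxy⟩ := h' p (Finset.mem_erase.mpr ⟨hpq, hp⟩)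
        obtain ⟨k, hk⟩ : p ∣ N' := Finset.dvd_prod_of_mem _ (Finset.mem_erase.mpr ⟨hpq, hp⟩)
        refine ⟨a, ha, y - (k : ℤ) • (t • x), X.O₀.sub_mem hy (X.O₀.smul_mem _ (X.O₀.smul_mem _ hx)), ?_⟩
        have e : x₁ - a = (x - a) - ((N' : ℕ) : ℤ) • (t • x) := by rw [hx₁]; abel
        rw [e, hxy, hk, smul_sub, smul_smul (p : ℤ) (k : ℤ)]
        push_cast
        rfl
    have e : x = x₁ + ((N' : ℕ) : ℤ) • (t • x) := by rw [hx₁]; abel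
    rw [e]
    exact (X.eraseOrder q).add_mem (X.le_eraseOrder q hx₁O) (X.smul_mem_eraseOrder q (X.O₀.smul_mem _ hx))
  · rw [X.eraseOrder_eq_of_not_mem hq]
    refine X.saturated x hx fun p hp => ?_
    have hp' : p ∈ C.erase q := by rwa [Finset.erase_eq_of_notMem hq]
    exact h' p hp'

/-- **The division-ring property of the cover order modulo `p ∈ C∖q`**: an element of `O'` not in
`p O₀` is invertible modulo `p O₀` with an inverse in `O'` (from `X.isDivisionRing_mod` applied to
its `O`-component). [cite: KohenPacetti2016, §1.1 (O ⊗ 𝔽_p ≅ 𝔽_{p²})] -/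
theorem eraseOrder_isDivisionRing_mod {q p : ℕ} (hp : p ∈ C.erase q) {x : X.B}
    (hx : x ∈ X.eraseOrder q) (hxp : ¬ ∃ y ∈ X.O₀, x = (p : ℤ) • y) :
    ∃ z ∈ X.eraseOrder q, ∃ y ∈ X.O₀, x * z - 1 = (p : ℤ) • y := by
  classical
  obtain ⟨a, ha, w, hw, rfl⟩ := (X.mem_eraseOrder_iff q).mp hx
  obtain ⟨k, hk⟩ : p ∣ ∏ p' ∈ C.erase q, p' := Finset.dvd_prod_of_mem _ hp
  have hO₀ := X.isEichlerOrder.isOrder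
  have hap : ¬ ∃ y ∈ X.O₀, a = (p : ℤ) • y := by
    rintro ⟨y, hy, hay⟩
    refine hxp ⟨y + (k : ℤ) • w, X.O₀.add_mem hy (X.O₀.smul_mem _ hw), ?_⟩
    rw [hay, hk, smul_add, smul_smul]
    push_cast
    rfl
  obtain ⟨z, hz, y, hy, hazy⟩ := X.isDivisionRing_mod p (Finset.mem_of_mem_erase hp) a ha hap
  refine ⟨z, X.le_eraseOrder q hz, y + (k : ℤ) • (w * z),
    X.O₀.add_mem hy (X.O₀.smul_mem _ (hO₀.mul_mem w hw z (X.le hz))), ?_⟩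
  have e : (a + (((∏ p' ∈ C.erase q, p' : ℕ) : ℤ)) • w) * z - 1 =
      (a * z - 1) + (((∏ p' ∈ C.erase q, p' : ℕ) : ℤ)) • (w * z) := by
    rw [add_mul, smul_mul_assoc]; abel
  rw [e, hazy, hk, smul_add, smul_smul]
  push_cast
  rfl

/-! ### 4. The Cartan datum of level `(M; C∖q)` -/

/-- **The cover order as a Cartan datum of level `(M; C∖q)`**: same algebra, splitting and hull as
`X`; `O := X.eraseOrder q`; a measurable exact fundamental domain of `ι(O'¹)` chosen by
`exists_isHypFundamentalDomain_normOneUnits_of_algHom`. Its norm-one group `(X.eraseLevel q).Gamma` is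
`normOneUnits X.ι _` of the cover order (the BSD cell's `CartanCover.coverUnits X q`), and its Hecke
sets ∕ operators are those of `QuaternionOrderHeckeJacquetLanglands.lean` for the cover order.
[cite: KohenPacetti2016, §2 (arXiv:1403.7801v3 pp. 7–8)] [cite: VignerasLNM800, Ch. IV §1] -/
def eraseLevel (q : ℕ) : CartanLevelCurveData D M (C.erase q) where
  B := X.B
  squarefree := X.squarefree
  ramifiedPlaces_eq := X.ramifiedPlaces_eq
  coprime := fun p hp => X.coprime p (Finset.mem_of_mem_erase hp)
  O₀ := X.O₀
  isEichlerOrder := X.isEichlerOrder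
  O := X.eraseOrder q
  isOrder := X.isOrder_eraseOrder q
  le := X.eraseOrder_le q
  smul_mem := fun _ hx => X.smul_mem_eraseOrder q hx
  relIndex_eq := X.relIndex_eraseOrder q
  saturated := fun _ hx h => X.eraseOrder_saturated q hx h
  isDivisionRing_mod := fun _ hp _ hx hxp => X.eraseOrder_isDivisionRing_mod hp hx hxp
  ι := X.ι
  ι_injective := X.ι_injective
  fd := Classical.choose (exists_isHypFundamentalDomain_normOneUnits_of_algHom X.ι (X.isOrder_eraseOrder q))
  isFundamentalDomain_fd :=
    Classical.choose_spec (exists_isHypFundamentalDomain_normOneUnits_of_algHom X.ι (X.isOrder_eraseOrder q))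

/-- The algebra of the erased datum is that of `X`. [cite: KohenPacetti2016, §2] -/
theorem eraseLevel_B (q : ℕ) : (X.eraseLevel q).B = X.B := rfl

/-- The order of the erased datum is the cover order. [cite: KohenPacetti2016, §2] -/
theorem eraseLevel_O (q : ℕ) : (X.eraseLevel q).O = X.eraseOrder q := rfl

/-- The hull of the erased datum is that of `X`. [cite: KohenPacetti2016, §2] -/
theorem eraseLevel_O₀ (q : ℕ) : (X.eraseLevel q).O₀ = X.O₀ := rfl

/-- The real splitting of the erased datum is that of `X`. [cite: KohenPacetti2016, §2] -/
theorem eraseLevel_ι (q : ℕ) : (X.eraseLevel q).ι = X.ι := rfl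

/-- **The level group of the erased datum is the norm-one group of the cover order**
(`normOneUnits X.ι hO'` for ANY proof `hO'` that the cover order is an order — proof irrelevance).
[cite: KohenPacetti2016, §2] [cite: VignerasLNM800, Ch. IV §1] -/
theorem Gamma_eraseLevel (q : ℕ)
    (hO' : Brandt.IsOrder X.B (X.O ⊔ X.O₀.map ((((∏ p ∈ C.erase q, p : ℕ) : ℤ)) • LinearMap.id))) :
    (X.eraseLevel q).Gamma = normOneUnits X.ι hO' := rfl

/-- `X.Gamma ≤ (X.eraseLevel q).Gamma` (the Cartan curve covers the erased one).
[cite: KohenPacetti2016, §2] -/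
theorem Gamma_le_Gamma_eraseLevel (q : ℕ) : X.Gamma ≤ (X.eraseLevel q).Gamma := by
  rintro g ⟨⟨x, hx, hxg⟩, ⟨y, hy, hyg⟩, hdet⟩
  exact ⟨⟨x, X.le_eraseOrder q hx, hxg⟩, ⟨y, X.le_eraseOrder q hy, hyg⟩, hdet⟩

/-- The Hecke sets of the erased datum are those of the cover order: `ι(O'(n))`.
[cite: KohenPacetti2016, §1.3 and §2] -/
theorem mem_heckeSet_eraseLevel_iff (q n : ℕ) (g : GL (Fin 2) ℝ) :
    g ∈ (X.eraseLevel q).heckeSet n ↔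
      (∃ x ∈ X.eraseOrder q, X.ι x = (g : Matrix (Fin 2) (Fin 2) ℝ)) ∧
        (g : Matrix (Fin 2) (Fin 2) ℝ).det = n :=
  Iff.rfl

end CartanLevelCurveData

end Literature.NumberTheory.Automorphic

end
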